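import Mathlib
import Summits.NavierStokesRegularity.FluidComputer.LaplacianConvectFlux
import Summits.NavierStokesRegularity.FluidComputer.HighModePoincare
import Literature.Analysis.FunctionSpaces.TorusLinearisedNSEnergy
import HarnessLib

/-!
# The `H²` tail of the linearised Navier–Stokes operator is dissipative beyond an explicit mode number (instab g8, cell `ns-blowup`, 2026-08-25)

HONEST FRAMING (human ruling D-0035): nothing here is a claim about Navier–Stokes blow-up.
WHAT THIS IS NOT: not NS evidence. Kernel form (ball-truncation geometry, tree constants) of the TAIL
INEQUALITY of THEOREM 3-L (`instab/INSTAB-BRIDGE.md` §11 l.109, §12 (L5)): for a smooth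
divergence-free host `v` with pointwise bounds `‖∂ₖv‖ ≤ L`, `‖∂ⱼ∂ₖv‖ ≤ L'`, `‖∂ⱼΔv‖ ≤ L''`,
`‖Δv‖ ≤ L₂`, and a smooth TAIL field `w` (no Fourier modes in the ball `|k|² ≤ N²`), the quadratic form
of the linearisation `νΔ − (v·∇) − (·∇)v − ω` tested against `Δ²w` satisfies
`ν∫⟪ΔΔw, Δw⟫ − ∫⟪(v·∇)w + (w·∇)v, ΔΔw⟫ − ω‖Δw‖₂² ≤ c_N · ‖Δw‖₂²`,
`c_N = −νΛ_N − ω + (2d² + d)L + (dL₂ + 2d²L')Λ_N^{-1/2} + dL''Λ_N^{-1}`, `Λ_N = 4π²(N² + 1)`: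
NEGATIVE as soon as `νΛ_N + ω` beats constants that are LINEAR in the host's derivative bounds — no
`ν⁻¹`, courtesy of the `H²` skew identity (`LaplacianConvectCommutator`), the sharp fluxes
(`LaplacianConvectFlux`) and the high-mode Poincaré inequalities (`HighModePoincare`). (The Leray
projector is absent because `⟨Δ²w, ℙf⟩ = ⟨Δ²w, f⟩` for divergence-free `w`; the cube-shell version
with the sharp ABC constants `2√3 + √2`, `√6 + 2√3`, `√3` is `AbcH2TailConstants`.)

* `tail_form_le` — the inequality above.

Mathlib + the three landed FluidComputer files; no new definitions.
-/

noncomputable section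

namespace Summit.NavierStokesRegularity.FluidComputer.H2TailDissipativity

open Literature.Analysis.FunctionSpaces Literature.Analysis.FunctionSpaces.Torus MeasureTheory
open Summit.NavierStokesRegularity.FluidComputer.LaplacianConvectFlux
open Summit.NavierStokesRegularity.FluidComputer.HighModePoincare
open scoped RealInnerProductSpace

variable {d : Type*} [Fintype d] [DecidableEq d]

/-- **Tail dissipativity of the linearised operator in `H²` (THEOREM 3-L, tail inequality).** See the
module docstring for the statement; `Y := ∫‖Δw‖²`. -/
theorem tail_form_le {v w : UnitAddTorus d → EuclideanSpace ℝ d}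
    (hv : IsSmooth v) (hdiv : IsDivFree v) (hw : IsSmooth w) {N : ℕ}
    (h0 : fourierTruncate N w = fun _ => 0) {ν ω L L' L'' L₂ : ℝ} (hν : 0 ≤ ν)
    (hL0 : 0 ≤ L) (hL'0 : 0 ≤ L') (hL''0 : 0 ≤ L'') (hL₂0 : 0 ≤ L₂)
    (hL : ∀ (k : d) (x : UnitAddTorus d), ‖partialDeriv k v x‖ ≤ L)
    (hL' : ∀ (j k : d) (x : UnitAddTorus d), ‖partialDeriv j (partialDeriv k v) x‖ ≤ L')
    (hL'' : ∀ (j : d) (x : UnitAddTorus d), ‖partialDeriv j (laplacian v) x‖ ≤ L'')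
    (hL₂ : ∀ x : UnitAddTorus d, ‖laplacian v x‖ ≤ L₂) :
    ν * (∫ x, ⟪laplacian (laplacian w) x, laplacian w x⟫)
      - (∫ x, ⟪convect v w x + convect w v x, laplacian (laplacian w) x⟫)
      - ω * (∫ x, ‖laplacian w x‖ ^ 2)
      ≤ (-(ν * (4 * Real.pi ^ 2 * ((N : ℝ) ^ 2 + 1))) - ω
          + ((2 * (Fintype.card d : ℝ) ^ 2 + (Fintype.card d : ℝ)) * L)
          + ((Fintype.card d : ℝ) * L₂ + 2 * (Fintype.card d : ℝ) ^ 2 * L')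
              / Real.sqrt (4 * Real.pi ^ 2 * ((N : ℝ) ^ 2 + 1))
          + (Fintype.card d : ℝ) * L'' / (4 * Real.pi ^ 2 * ((N : ℝ) ^ 2 + 1)))
        * (∫ x, ‖laplacian w x‖ ^ 2) := by
  -- names
  set Λ : ℝ := 4 * Real.pi ^ 2 * ((N : ℝ) ^ 2 + 1) with hΛ
  set D : ℝ := (Fintype.card d : ℝ) with hD
  set Y : ℝ := ∫ x, ‖laplacian w x‖ ^ 2 with hY
  have hΛpos : 0 < Λ := by positivity
  have hΛ1 : 1 ≤ Λ := by
    have hπ : 1 ≤ Real.pi ^ 2 := by nlinarith [Real.pi_gt_three]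
    have : (1:ℝ) ≤ (N : ℝ) ^ 2 + 1 := by nlinarith [sq_nonneg (N : ℝ)]
    nlinarith
  have hD0 : 0 ≤ D := Nat.cast_nonneg _
  have hY0 : 0 ≤ Y := integral_nonneg fun x => sq_nonneg _
  have hsΛ : 0 < Real.sqrt Λ := Real.sqrt_pos.mpr hΛpos
  -- the smooth pieces
  have hΔw : IsSmooth (laplacian w) := hw.laplacian
  -- (1) the viscous term: ∫⟪ΔΔw, Δw⟫ = -‖∇Δw‖² ≤ -Λ Y
  have hvisc : ∫ x, ⟪laplacian (laplacian w) x, laplacian w x⟫ ≤ -(Λ * Y) := by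
    rw [integral_inner_laplacian_self_eq_neg_gradNormSq_of_isSmooth hΔw]
    have h := integral_norm_laplacian_sq_le_of_truncate_eq_zero hw h0
    linarith
  -- (2) Poincaré bounds for the lower-order norms of the tail field
  have hG : gradNormSq w ≤ Y / Λ := by
    rw [le_div_iff₀ hΛpos, mul_comm]
    exact gradNormSq_le_of_truncate_eq_zero hw h0
  have hwL2 : ∫ x, ‖w x‖ ^ 2 ≤ Y / Λ ^ 2 := by
    have h1 := integral_norm_sq_le_of_truncate_eq_zero hw h0
    have h2 : Λ * ∫ x, ‖w x‖ ^ 2 ≤ Y / Λ := h1.trans hG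
    rw [le_div_iff₀ hΛpos] at h2
    rw [le_div_iff₀ (by positivity)]
    nlinarith
  have hia : ∀ j, Integrable (fun x => ‖partialDeriv j w x‖ ^ 2) volume := fun j =>
    (((hw.partialDeriv j).continuous.norm).pow 2).integrable_of_hasCompactSupport
      (HasCompactSupport.of_compactSpace _)
  have hbj : ∀ j, ∫ x, ‖partialDeriv j w x‖ ^ 2 ≤ Y / Λ := by
    intro j
    have h1 : ∫ x, ‖partialDeriv j w x‖ ^ 2 ≤ gradNormSq w := by
      rw [gradNormSq, integral_finsetSum _ fun i _ => hia i]
      exact Finset.single_le_sum (f := fun i => ∫ x, ‖partialDeriv i w x‖ ^ 2)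
        (fun i _ => integral_nonneg fun x => sq_nonneg _) (Finset.mem_univ j)
    exact h1.trans hG
  have hamj : ∀ m j, ∫ x, ‖partialDeriv j (partialDeriv m w) x‖ ^ 2 ≤ Y := by
    intro m j
    have hiam : ∀ i, Integrable (fun x => ‖partialDeriv i (partialDeriv m w) x‖ ^ 2) volume :=
      fun i => ((((hw.partialDeriv m).partialDeriv i).continuous.norm).pow 2).integrable_of_hasCompactSupport
        (HasCompactSupport.of_compactSpace _)
    have h1 : ∫ x, ‖partialDeriv j (partialDeriv m w) x‖ ^ 2 ≤ gradNormSq (partialDeriv m w) := by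
      rw [gradNormSq, integral_finsetSum _ fun i _ => hiam i]
      exact Finset.single_le_sum (f := fun i => ∫ x, ‖partialDeriv i (partialDeriv m w) x‖ ^ 2)
        (fun i _ => integral_nonneg fun x => sq_nonneg _) (Finset.mem_univ j)
    have h2 : gradNormSq (partialDeriv m w) ≤ ∑ m', gradNormSq (partialDeriv m' w) :=
      Finset.single_le_sum (f := fun m' => gradNormSq (partialDeriv m' w))
        (fun m' _ => gradNormSq_nonneg _) (Finset.mem_univ m)
    rw [sum_gradNormSq_partialDeriv_eq hw] at h2
    exact h1.trans h2
  -- square-root forms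
  have hsqY : Real.sqrt Y ^ 2 = Y := Real.sq_sqrt hY0
  have hs_a : ∀ m j, Real.sqrt (∫ x, ‖partialDeriv j (partialDeriv m w) x‖ ^ 2) ≤ Real.sqrt Y :=
    fun m j => Real.sqrt_le_sqrt (hamj m j)
  have hs_b : ∀ j, Real.sqrt (∫ x, ‖partialDeriv j w x‖ ^ 2) ≤ Real.sqrt Y / Real.sqrt Λ := by
    intro j
    rw [← Real.sqrt_div hY0]
    exact Real.sqrt_le_sqrt (hbj j)
  have hs_w : Real.sqrt (∫ x, ‖w x‖ ^ 2) ≤ Real.sqrt Y / Λ := by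
    have h := Real.sqrt_le_sqrt hwL2
    rwa [Real.sqrt_div hY0, Real.sqrt_sq hΛpos.le] at h
  -- sums of the square roots
  have hsum_a : (∑ m, ∑ j, Real.sqrt (∫ x, ‖partialDeriv j (partialDeriv m w) x‖ ^ 2)) ≤ D ^ 2 * Real.sqrt Y := by
    calc (∑ m, ∑ j, Real.sqrt (∫ x, ‖partialDeriv j (partialDeriv m w) x‖ ^ 2))
        ≤ ∑ _m : d, ∑ _j : d, Real.sqrt Y :=
          Finset.sum_le_sum fun m _ => Finset.sum_le_sum fun j _ => hs_a m j
      _ = D ^ 2 * Real.sqrt Y := by simp [hD]; ring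
  have hsum_b : (∑ j, Real.sqrt (∫ x, ‖partialDeriv j w x‖ ^ 2)) ≤ D * (Real.sqrt Y / Real.sqrt Λ) := by
    calc (∑ j, Real.sqrt (∫ x, ‖partialDeriv j w x‖ ^ 2)) ≤ ∑ _j : d, Real.sqrt Y / Real.sqrt Λ :=
          Finset.sum_le_sum fun j _ => hs_b j
      _ = D * (Real.sqrt Y / Real.sqrt Λ) := by simp [hD]
  -- (3) the flux bound
  have hflux := abs_integral_inner_linearised_bilaplacian_le hv hdiv hw hL0 hL'0 hL''0 hL hL' hL'' hL₂
  have hsY0 : 0 ≤ Real.sqrt Y := Real.sqrt_nonneg _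
  -- bound the bracket of the flux lemma by B √Y
  set B : ℝ := (2 * D ^ 2 + D) * L + (D * L₂ + 2 * D ^ 2 * L') / Real.sqrt Λ + D * L'' / Λ with hB
  have hbr : (2 * L * (∑ m, ∑ j, Real.sqrt (∫ x, ‖partialDeriv j (partialDeriv m w) x‖ ^ 2))
            + L₂ * (∑ j, Real.sqrt (∫ x, ‖partialDeriv j w x‖ ^ 2)))
          + D * (L'' * Real.sqrt (∫ x, ‖w x‖ ^ 2)
            + 2 * L' * (∑ m, Real.sqrt (∫ x, ‖partialDeriv m w x‖ ^ 2))
            + L * Real.sqrt (∫ x, ‖laplacian w x‖ ^ 2))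
        ≤ B * Real.sqrt Y := by
    have e1 : 2 * L * (∑ m, ∑ j, Real.sqrt (∫ x, ‖partialDeriv j (partialDeriv m w) x‖ ^ 2))
        ≤ 2 * L * (D ^ 2 * Real.sqrt Y) := mul_le_mul_of_nonneg_left hsum_a (by linarith)
    have e2 : L₂ * (∑ j, Real.sqrt (∫ x, ‖partialDeriv j w x‖ ^ 2)) ≤ L₂ * (D * (Real.sqrt Y / Real.sqrt Λ)) :=
      mul_le_mul_of_nonneg_left hsum_b hL₂0
    have e3 : L'' * Real.sqrt (∫ x, ‖w x‖ ^ 2) ≤ L'' * (Real.sqrt Y / Λ) := mul_le_mul_of_nonneg_left hs_w hL''0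
    have e4 : 2 * L' * (∑ m, Real.sqrt (∫ x, ‖partialDeriv m w x‖ ^ 2)) ≤ 2 * L' * (D * (Real.sqrt Y / Real.sqrt Λ)) :=
      mul_le_mul_of_nonneg_left hsum_b (by linarith)
    have e5 : L * Real.sqrt (∫ x, ‖laplacian w x‖ ^ 2) = L * Real.sqrt Y := by rw [hY]
    have hsum := add_le_add (add_le_add e1 e2) (mul_le_mul_of_nonneg_left (add_le_add (add_le_add e3 e4) (le_of_eq e5)) hD0)
    refine hsum.trans (le_of_eq ?_)
    simp only [hB]
    field_simp
    ring
  have hflux' : |∫ x, ⟪convect v w x + convect w v x, laplacian (laplacian w) x⟫| ≤ B * Y := by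
    have h := hflux.trans (mul_le_mul_of_nonneg_right hbr hsY0)
    have e : B * Real.sqrt Y * Real.sqrt (∫ x, ‖laplacian w x‖ ^ 2) = B * Y := by
      rw [← hY, mul_assoc, ← sq, hsqY]
    rwa [e] at h
  -- (4) assemble
  have hT : -(∫ x, ⟪convect v w x + convect w v x, laplacian (laplacian w) x⟫) ≤ B * Y :=
    (neg_le_abs _).trans hflux'
  have hv' : ν * (∫ x, ⟪laplacian (laplacian w) x, laplacian w x⟫) ≤ -(ν * (Λ * Y)) := by
    have := mul_le_mul_of_nonneg_left hvisc hν; linarith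
  have key : ν * (∫ x, ⟪laplacian (laplacian w) x, laplacian w x⟫)
      - (∫ x, ⟪convect v w x + convect w v x, laplacian (laplacian w) x⟫)
      - ω * Y ≤ (-(ν * Λ) - ω + B) * Y := by nlinarith
  have e : (-(ν * Λ) - ω + B) * Y
      = (-(ν * Λ) - ω + ((2 * D ^ 2 + D) * L) + (D * L₂ + 2 * D ^ 2 * L') / Real.sqrt Λ
          + D * L'' / Λ) * Y := by
    simp only [hB]; ring
  rw [e] at key
  exact key

end Summit.NavierStokesRegularity.FluidComputer.H2TailDissipativity
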